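/-
Copyright (c) 2026. All rights reserved.
Released under Apache 2.0 license as described in the file LICENSE.
Authors: HodgeCM publication cell (pub-hodgecm), GR lane, seat GR-1 (`pub-hodgecm-own-real34`).
-/
import Literature.NumberTheory.GelbartRogawski1991.DoubledUnitaryArchSiegelDiagonalModulusGen
import Literature.NumberTheory.GelbartRogawski1991.QuadExtSplittingCharArchTwistComplex
import Literature.NumberTheory.Automorphic.UnitaryGroupArchRealPair
import HarnessLib

/-!
# The sign of the archimedean Siegel element at the real places of `E`: `sign det α_w · sign det α_{cw} = sign det g_w`

Topic `NumberTheory/GelbartRogawski1991`; namespace `Literature.NumberTheory.GelbartRogawski1991.GRConstructionGen`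
(telescope of `DoubledUnitaryGlobalSplittingDataGen`).  KERNEL only: proved theorems; no definition, no named fact, no
`sorry`.  The bridge «B1» between the sign `sgnA g = ∏_{w real} sign det α_w` of the signed modulus input
(`DoubledUnitaryArchSiegelDiagonalModulusReal.exists_archAct_diagPair_det_eq_sign_mul_modDelta_sq`, `α = deltaBlock (g,1)`,
the action of `g ∈ P_Δ(F ⊗ ℝ)` on `Δ`) and the quantities of the archimedean Weil section at the split real places
(`Weil1964/ArchLeviSectionQuotientSign.quot_archSectionRealSplit = sign det g_w`):

* §1 **`det_evalR_mul_det_deltaBlock_eq`** — for `(g, 1) ∈ P_Δ(𝔸)` and a real place `w` of `E`: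
  `det g_w · (det α)_{c⁻¹ w} = (det α)_w` (the identity `det g · (c ⊗ 1)(det α) = det α` over `E ⊗ ℝ`,
  `AdaptedBlocks.det_mul_map_det_deltaBlock_reindex`, read at `w` with `((c ⊗ 1) x)_w = x_{c⁻¹ w}`,
  `UnitaryGroup.conjMixed_fst_eq`); hence **`sign_det_deltaBlock_mul_sign_eq`**:
  `sign (det α)_w · sign (det α)_{c⁻¹ w} = sign det g_w`;
* §2 **`prod_sign_det_deltaBlock_eq_prod_sign_det`** — summing over the `c`-orbits `{w, c w}` of the real places of `E`
  (all of size `2`: they lie over the real places of `F` split in `E`), for any enumeration `κ ⊕ κ ≃ {w real}`,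
  `(inl k ↦ w_k, inr k ↦ c⁻¹ w_k)`: `∏_{w real} sign (det α)_w = ∏_k sign det g_{w_k}`.  So the squares condition
  `hηS` of `DoubledWeilRepresentationArchLiftReps` reads `η(g)² · quot(sW g) · ∏_k sign det g_{w_k} = χ(det_Δ)²`, in which
  the type-(ii) signs of `quot` CANCEL.

([Kudla1994, §3], case `E_v = F_v ⊕ F_v`: `x(m(a)) = det a`, `P = MN`; [HarrisKudlaSweet1996, §1 (1.11)–(1.12)];
archimedean places of type (ii) of [GelbartRogawski1991, Prop. 3.1.1].)  Written for the stage-1 cell `pub-hodgecm`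
(seat GR-1); nothing here is a claim of the manuscripts adjudicated by that cell.

## References

* S. S. Kudla, Israel J. Math. 87 (1994) 361–401, §3 [Kudla1994].
* M. Harris, S. S. Kudla, W. J. Sweet, J. Amer. Math. Soc. 9 (1996), §1 (1.11)–(1.12) [HarrisKudlaSweet1996].
* S. Gelbart, J. Rogawski, Invent. Math. 105 (1991), §3.1 Prop. 3.1.1 p. 455 [GelbartRogawski1991].
* V. Platonov, A. Rapinchuk, *Algebraic Groups and Number Theory* (1994), §2.3 [PlatonovRapinchuk1994].
-/

set_option autoImplicit false

noncomputable section

open scoped Classical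
open scoped Matrix
open NumberField NumberField.InfinitePlace NumberField.mixedEmbedding IsDedekindDomain
open Literature.NumberTheory.Automorphic Literature.NumberTheory.Automorphic.UnitaryGroup
open Literature.NumberTheory.Weil1964
open Literature.NumberTheory.GaloisRepresentations
open Literature.RepresentationTheory.HeisenbergGroup
open Literature.NumberTheory.GelbartRogawski1991.AdaptedBlocks
open Literature.NumberTheory.GelbartRogawski1991.UnitaryDualPair.ArchSplitting.QuadExt

namespace Literature.NumberTheory.GelbartRogawski1991.GRConstructionGen

open UnitaryDualPair QuadraticCoordinates

variable (F : Type) [Field F] [NumberField F] (E : Type) [Field E] [NumberField E] [Algebra F E]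
  [Algebra.IsQuadraticExtension F E]
variable (c : E ≃ₐ[F] E) {δ : E} (hcδ : c δ = -δ) (hδ : δ ≠ 0) {d : F} (hd : δ * δ = algebraMap F E d)
variable {N M n : ℕ} (e : Fin N × Fin M ≃ Fin n)
  (TV : Matrix (Fin N) (Fin N) F) (hV : TV.IsSymm) (hVd : IsUnit TV.det)
  (TW : Matrix (Fin M) (Fin M) F) (hW : TW.IsSymm) (hWd : IsUnit TW.det)

/-! ## §1 `det g_w · (det α)_{c⁻¹ w} = (det α)_w` at a real place `w` of `E` -/

omit [NumberField F] [Algebra F E] [Algebra.IsQuadraticExtension F E] in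
/-- the archimedean part, read in `E ⊗ ℝ`, of a matrix: `archMat X = X.map ρ`, `ρ = (E_∞ ≅ E ⊗ ℝ) ∘ (·)_∞`.
[cite: Kudla1994, §3] -/
theorem archMat_eq_map {k : Type} [Fintype k] (X : Matrix k k (AdeleRing (𝓞 E) E)) :
    archMat E k X = X.map ((InfiniteAdeleRing.ringEquiv_mixedSpace E).toRingHom.comp (adeleFst E)) := rfl

omit [Algebra.IsQuadraticExtension F E] in
/-- **`archMat (deltaBlock (g,1)) = (e₂⁻¹ g e₂)₁₁ + (e₂⁻¹ g e₂)₁₂` over `E ⊗ ℝ`**: the archimedean part of `α = deltaBlock (g,1)` is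
the Siegel block of the matrix `g ∈ GL_{n+n}(E ⊗ ℝ)` itself. [cite: Kudla1994, §3] -/
theorem archMat_deltaBlock_archToAdelic (g : arch F E c (n + n) (hermD F E e TV TW)) :
    archMat E (Fin n) (deltaBlock F E c e TV TW (UnitaryGroup.archToAdelic F E c (n + n) (hermD F E e TV TW) g)) =
      (Matrix.reindex finSumFinEquiv.symm finSumFinEquiv.symm
          (((g : GL (Fin (n + n)) (mixedSpace E)) : Matrix (Fin (n + n)) (Fin (n + n)) (mixedSpace E)))).toBlocks₁₁ +
        (Matrix.reindex finSumFinEquiv.symm finSumFinEquiv.symm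
          (((g : GL (Fin (n + n)) (mixedSpace E)) : Matrix (Fin (n + n)) (Fin (n + n)) (mixedSpace E)))).toBlocks₁₂ := by
  set ρ : AdeleRing (𝓞 E) E →+* mixedSpace E :=
    (InfiniteAdeleRing.ringEquiv_mixedSpace E).toRingHom.comp (adeleFst E) with hρ
  set M : Matrix (Fin (n + n)) (Fin (n + n)) (AdeleRing (𝓞 E) E) :=
    (((UnitaryGroup.archToAdelic F E c (n + n) (hermD F E e TV TW) g).1 : GL (Fin (n + n)) (AdeleRing (𝓞 E) E)) :
      Matrix (Fin (n + n)) (Fin (n + n)) (AdeleRing (𝓞 E) E)) with hM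
  have hmap : M.map ρ = (((g : GL (Fin (n + n)) (mixedSpace E)) : Matrix (Fin (n + n)) (Fin (n + n)) (mixedSpace E))) := by
    have h1 : M.map (adeleFst E) =
        (((g : GL (Fin (n + n)) (mixedSpace E)) : Matrix (Fin (n + n)) (Fin (n + n)) (mixedSpace E))).map
          (InfiniteAdeleRing.ringEquiv_mixedSpace E).symm.toRingHom :=
      map_fst_ofInfinite E (n + n) (g : GL (Fin (n + n)) (mixedSpace E))
    have h2 : M.map ρ = (M.map (adeleFst E)).map (InfiniteAdeleRing.ringEquiv_mixedSpace E) := by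
      rw [Matrix.map_map]; rfl
    rw [h2, h1, Matrix.map_map]
    exact Matrix.ext fun i j => (InfiniteAdeleRing.ringEquiv_mixedSpace E).apply_symm_apply _
  rw [archMat_eq_map, ← hρ]
  show ((Matrix.reindex finSumFinEquiv.symm finSumFinEquiv.symm M).toBlocks₁₁ +
      (Matrix.reindex finSumFinEquiv.symm finSumFinEquiv.symm M).toBlocks₁₂).map ρ = _
  rw [← hmap, Matrix.map_add ρ (map_add ρ)]
  rfl

omit [Algebra.IsQuadraticExtension F E] in
include hVd hWd in
/-- **`det g_w · (det α)_{c⁻¹ w} = (det α)_w`** for `(g, 1) ∈ P_Δ(𝔸)` at every real place `w` of `E` (`α = deltaBlock (g,1)`;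
the determinant of the unitarity relation on the Siegel parabolic, `det g · (c ⊗ 1)(det α) = det α` over `E ⊗ ℝ`, read at
`w`). [cite: Kudla1994, §3] [cite: HarrisKudlaSweet1996, §1 (1.11)–(1.12)] -/
theorem det_evalR_mul_det_deltaBlock_eq (hcc : c * c = 1) (g : arch F E c (n + n) (hermD F E e TV TW))
    (hS : IsSiegelDelta F E c e TV TW (UnitaryGroup.archToAdelic F E c (n + n) (hermD F E e TV TW) g))
    (w : {w : InfinitePlace E // w.IsReal}) :
    ((((g : GL (Fin (n + n)) (mixedSpace E)) : Matrix (Fin (n + n)) (Fin (n + n)) (mixedSpace E))).map (evalR E w)).det *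
        (archMat E (Fin n) (deltaBlock F E c e TV TW (UnitaryGroup.archToAdelic F E c (n + n) (hermD F E e TV TW) g))).det.1
          ⟨c⁻¹ • w.1, isReal_smul_iff.mpr w.2⟩ =
      (archMat E (Fin n) (deltaBlock F E c e TV TW (UnitaryGroup.archToAdelic F E c (n + n) (hermD F E e TV TW) g))).det.1 w := by
  set G : Matrix (Fin (n + n)) (Fin (n + n)) (mixedSpace E) :=
    (((g : GL (Fin (n + n)) (mixedSpace E)) : Matrix (Fin (n + n)) (Fin (n + n)) (mixedSpace E))) with hG
  -- (1) the unitarity relation over `E ⊗ ℝ` in doubled form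
  haveI : Invertible (2 : mixedSpace E) :=
    (Invertible.map (algebraMap ℝ (mixedSpace E)) 2).copy 2 (map_ofNat (algebraMap ℝ (mixedSpace E)) 2).symm
  have hJD : hermD F E e TV TW =
      (Matrix.reindex finSumFinEquiv finSumFinEquiv (Matrix.fromBlocks (gramR F e TV TW) 0 0 (-gramR F e TV TW))).map
        (algebraMap F E) := rfl
  have hmem : (G.map (conjMixed F E c))ᵀ *
        Matrix.reindex finSumFinEquiv finSumFinEquiv
          (Matrix.fromBlocks ((gramR F e TV TW).map ((mixedEmbedding E).comp (algebraMap F E))) 0 0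
            (-(gramR F e TV TW).map ((mixedEmbedding E).comp (algebraMap F E)))) * G =
      Matrix.reindex finSumFinEquiv finSumFinEquiv
        (Matrix.fromBlocks ((gramR F e TV TW).map ((mixedEmbedding E).comp (algebraMap F E))) 0 0
          (-(gramR F e TV TW).map ((mixedEmbedding E).comp (algebraMap F E)))) := by
    have h := (mem_arch_iff F E c (n + n) (hermD F E e TV TW) (g : GL (Fin (n + n)) (mixedSpace E))).1 g.2
    rwa [archFormOf_doubledGram F E (gramR F e TV TW) (hermD F E e TV TW) hJD] at h
  have hT : IsUnit (gramR F e TV TW).det := isUnit_det_gram F e hVd hWd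
  have hTinf : IsUnit ((gramR F e TV TW).map ((mixedEmbedding E).comp (algebraMap F E))).det := by
    have h := hT.map ((mixedEmbedding E).comp (algebraMap F E))
    rwa [RingHom.map_det, RingHom.mapMatrix_apply] at h
  -- (2) the Siegel relation over `E ⊗ ℝ`
  have hA := archMat_deltaBlock_archToAdelic F E c e TV TW g
  have hS' : (Matrix.reindex finSumFinEquiv.symm finSumFinEquiv.symm G).toBlocks₁₁ +
        (Matrix.reindex finSumFinEquiv.symm finSumFinEquiv.symm G).toBlocks₁₂ =
      (Matrix.reindex finSumFinEquiv.symm finSumFinEquiv.symm G).toBlocks₂₁ +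
        (Matrix.reindex finSumFinEquiv.symm finSumFinEquiv.symm G).toBlocks₂₂ := by
    set ρ : AdeleRing (𝓞 E) E →+* mixedSpace E :=
      (InfiniteAdeleRing.ringEquiv_mixedSpace E).toRingHom.comp (adeleFst E) with hρ
    set M : Matrix (Fin (n + n)) (Fin (n + n)) (AdeleRing (𝓞 E) E) :=
      (((UnitaryGroup.archToAdelic F E c (n + n) (hermD F E e TV TW) g).1 : GL (Fin (n + n)) (AdeleRing (𝓞 E) E)) :
        Matrix (Fin (n + n)) (Fin (n + n)) (AdeleRing (𝓞 E) E)) with hM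
    have hmap : M.map ρ = G := by
      have h1 : M.map (adeleFst E) = G.map (InfiniteAdeleRing.ringEquiv_mixedSpace E).symm.toRingHom :=
        map_fst_ofInfinite E (n + n) (g : GL (Fin (n + n)) (mixedSpace E))
      have h2 : M.map ρ = (M.map (adeleFst E)).map (InfiniteAdeleRing.ringEquiv_mixedSpace E) := by
        rw [Matrix.map_map]; rfl
      rw [h2, h1, Matrix.map_map]
      exact Matrix.ext fun i j => (InfiniteAdeleRing.ringEquiv_mixedSpace E).apply_symm_apply _
    have h := congrArg (fun X : Matrix (Fin n) (Fin n) (AdeleRing (𝓞 E) E) => X.map ρ) hS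
    simp only [Matrix.map_add ρ (map_add ρ)] at h
    rw [← hmap]
    exact h
  -- (3) `det G · (c ⊗ 1)(det α_∞) = det α_∞` over `E ⊗ ℝ`, read at `w`
  have hσ : ∀ x : mixedSpace E, conjMixed F E c (conjMixed F E c x) = x := fun x => by
    have h := conjMixed_inv_apply F E c x
    rwa [inv_eq_of_mul_eq_one_right hcc] at h
  have key := det_mul_map_det_deltaBlock_reindex finSumFinEquiv hmem hS' hTinf hσ
  rw [← hA] at key
  have hk := congrArg (evalR E w) key
  rw [map_mul, RingHom.map_det, RingHom.mapMatrix_apply, evalR_apply, evalR_apply, conjMixed_fst_eq] at hk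
  exact hk

omit [NumberField F] [Field E] [NumberField E] [Algebra F E] [Algebra.IsQuadraticExtension F E] in
/-- signs in a product of non-zero reals: `a b = x` ⇒ `sign x · sign b = sign a`. [cite: Kudla1994, §3] -/
theorem sign_mul_sign_of_mul_eq {a b x : ℝ} (h : a * b = x) (ha : a ≠ 0) (hb : b ≠ 0) :
    Real.sign x * Real.sign b = Real.sign a := by
  subst h
  rcases lt_or_gt_of_ne ha with ha' | ha' <;> rcases lt_or_gt_of_ne hb with hb' | hb'
  · rw [Real.sign_of_pos (mul_pos_of_neg_of_neg ha' hb'), Real.sign_of_neg hb', Real.sign_of_neg ha']; norm_num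
  · rw [Real.sign_of_neg (mul_neg_of_neg_of_pos ha' hb'), Real.sign_of_pos hb', Real.sign_of_neg ha']; norm_num
  · rw [Real.sign_of_neg (mul_neg_of_pos_of_neg ha' hb'), Real.sign_of_neg hb', Real.sign_of_pos ha']; norm_num
  · rw [Real.sign_of_pos (mul_pos ha' hb'), Real.sign_of_pos hb', Real.sign_of_pos ha']; norm_num

omit [Algebra.IsQuadraticExtension F E] in
include hVd hWd in
/-- **`sign (det α)_w · sign (det α)_{c⁻¹ w} = sign det g_w`** for `(g, 1) ∈ P_Δ(𝔸)` at every real place `w` of `E`.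
[cite: Kudla1994, §3] [cite: HarrisKudlaSweet1996, §1 (1.11)–(1.12)] -/
theorem sign_det_deltaBlock_mul_sign_eq (hcc : c * c = 1) (g : arch F E c (n + n) (hermD F E e TV TW))
    (hS : IsSiegelDelta F E c e TV TW (UnitaryGroup.archToAdelic F E c (n + n) (hermD F E e TV TW) g))
    (w : {w : InfinitePlace E // w.IsReal}) :
    Real.sign ((archMat E (Fin n) (deltaBlock F E c e TV TW (UnitaryGroup.archToAdelic F E c (n + n) (hermD F E e TV TW) g))).det.1 w) *
        Real.sign ((archMat E (Fin n) (deltaBlock F E c e TV TW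
          (UnitaryGroup.archToAdelic F E c (n + n) (hermD F E e TV TW) g))).det.1 ⟨c⁻¹ • w.1, isReal_smul_iff.mpr w.2⟩) =
      Real.sign ((((g : GL (Fin (n + n)) (mixedSpace E)) : Matrix (Fin (n + n)) (Fin (n + n)) (mixedSpace E))).map (evalR E w)).det := by
  set x : {w : InfinitePlace E // w.IsReal} → ℝ := fun w' =>
    (archMat E (Fin n) (deltaBlock F E c e TV TW (UnitaryGroup.archToAdelic F E c (n + n) (hermD F E e TV TW) g))).det.1 w'
    with hx
  have hu : IsUnit (detDelta F E c e TV TW (UnitaryGroup.archToAdelic F E c (n + n) (hermD F E e TV TW) g)) :=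
    isUnit_detDelta_of_isSiegelDelta F E c e TV TW _ hS
  have hx0 : ∀ w', x w' ≠ 0 := by
    intro w'
    set ρ : AdeleRing (𝓞 E) E →+* mixedSpace E :=
      (InfiniteAdeleRing.ringEquiv_mixedSpace E).toRingHom.comp (adeleFst E) with hρ
    have h2 : x w' = (evalR E w') (ρ (detDelta F E c e TV TW (UnitaryGroup.archToAdelic F E c (n + n) (hermD F E e TV TW) g))) := by
      show (archMat E (Fin n) (deltaBlock F E c e TV TW (UnitaryGroup.archToAdelic F E c (n + n) (hermD F E e TV TW) g))).det.1 w' = _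
      rw [archMat_eq_map, ← hρ, ← RingHom.mapMatrix_apply, ← RingHom.map_det]
      rfl
    rw [h2]
    exact ((hu.map ρ).map (evalR E w')).ne_zero
  have key := det_evalR_mul_det_deltaBlock_eq F E c e TV hVd TW hWd hcc g hS w
  have ha : ((((g : GL (Fin (n + n)) (mixedSpace E)) : Matrix (Fin (n + n)) (Fin (n + n)) (mixedSpace E))).map (evalR E w)).det ≠ 0 := by
    intro h0
    rw [h0, zero_mul] at key
    exact hx0 w key.symm
  exact sign_mul_sign_of_mul_eq key ha (hx0 _)

/-! ## §2 The product over the real places of `E`, orbit by orbit -/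

omit [Algebra.IsQuadraticExtension F E] in
include hVd hWd in
/-- **`∏_{w real} sign (det α)_w = ∏_k sign det g_{w_k}`** for `(g, 1) ∈ P_Δ(𝔸)`, for any enumeration of the real places
of `E` by `c`-orbits: `eκ : κ ⊕ κ ≃ {w real}` with `eκ (inl k) = w_k`, `eκ (inr k) = c⁻¹ w_k` (the real places of `E` lie
in pairs over the real places of `F` split in `E`).  With `sgnA g := ∏_{w real} sign (det α)_w`
(`DoubledUnitaryArchSiegelDiagonalModulusReal`) this is the factor of the squares condition `hηS` of
`DoubledWeilRepresentationArchLiftReps`, and it cancels the type-(ii) sign of `quot` of the archimedean Weil section.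
[cite: Kudla1994, §3] [cite: GelbartRogawski1991, §3.1 Prop. 3.1.1 p. 455] -/
theorem prod_sign_det_deltaBlock_eq_prod_sign_det (hcc : c * c = 1) {κ : Type*} [Fintype κ]
    (wOf : κ → {w : InfinitePlace E // w.IsReal}) (eκ : κ ⊕ κ ≃ {w : InfinitePlace E // w.IsReal})
    (he₁ : ∀ k, eκ (Sum.inl k) = wOf k) (he₂ : ∀ k, eκ (Sum.inr k) = ⟨c⁻¹ • (wOf k).1, isReal_smul_iff.mpr (wOf k).2⟩)
    (g : arch F E c (n + n) (hermD F E e TV TW))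
    (hS : IsSiegelDelta F E c e TV TW (UnitaryGroup.archToAdelic F E c (n + n) (hermD F E e TV TW) g)) :
    (∏ w : {w : InfinitePlace E // w.IsReal},
        Real.sign ((archMat E (Fin n) (deltaBlock F E c e TV TW
          (UnitaryGroup.archToAdelic F E c (n + n) (hermD F E e TV TW) g))).det.1 w)) =
      ∏ k, Real.sign ((((g : GL (Fin (n + n)) (mixedSpace E)) : Matrix (Fin (n + n)) (Fin (n + n)) (mixedSpace E))).map
        (evalR E (wOf k))).det := by
  set f : {w : InfinitePlace E // w.IsReal} → ℝ := fun w =>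
    Real.sign ((archMat E (Fin n) (deltaBlock F E c e TV TW
      (UnitaryGroup.archToAdelic F E c (n + n) (hermD F E e TV TW) g))).det.1 w) with hf
  rw [← Fintype.prod_equiv eκ (fun s => f (eκ s)) f (fun _ => rfl), Fintype.prod_sum_type, ← Finset.prod_mul_distrib]
  refine Finset.prod_congr rfl fun k _ => ?_
  rw [he₁, he₂]
  exact sign_det_deltaBlock_mul_sign_eq F E c e TV hVd TW hWd hcc g hS (wOf k)

end Literature.NumberTheory.GelbartRogawski1991.GRConstructionGen

end
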